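import Literature.AlgebraicGeometry.Frobenioids.PerfFactorialPrimes
import HarnessLib

/-!
# Frobenioids I, Definition 2.4 (i)(c)(d): the primary component of an element of a perf-factorial
# monoid at a prime, and the monoid statement of Proposition 4.1 (ii)

Mochizuki, *The geometry of Frobenioids I: the general theory*, Kyushu J. Math. **62** (2008)
293–400, §2 Definition 2.4 (i) (kurims pp. 47–48) and the proof of Proposition 4.1 (ii) (p. 76)
[cite: MochizukiFrdI2008, Def. 2.4(i) p.47].

From the factorization homomorphism `M^pf → M^rlf_factor = ∏_𝔮 M^rlf_𝔮` of Def. 2.4 (i)(c) and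
condition (d) ("if `a ∈ M^pf_factor` and `b ∈ M^pf` satisfy `Supp(a) ⊆ Supp(b)`, then `a ∈ M^pf`")
we extract, for `y ∈ M^pf` and a prime `𝔮`, the splitting `y = y₁ + y₂` into the `𝔮`-component
`y₁` (supported at `𝔮`, with the same `𝔮`-coordinate as `y`) and a `𝔮`-free part `y₂` ("the
primary factorizations", proof of Prop. 4.1 (ii)–(v), pp. 76–77); the `𝔮`-coordinate of a primary
element of the class `𝔮` is non-zero and all its other coordinates vanish; no element of `𝔮` divides
a `𝔮`-free element; a `𝔮`-supported element is `≼ p` for `p ∈ 𝔮`. With these, the monoid statement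
of Prop. 4.1 (ii) (p. 76: "for every equation `x_φ + x_ψ = x_φ' + x_ψ'`, where `x_φ', x_ψ' ≠ 0`,
there exists a `0 ≠ x_φ''` such that `x_φ'' ≤ x_φ, x_φ'' ≤ x_φ'`" iff `x_φ + x_ψ` is primary, for
`x_φ` primary, `x_ψ ≠ 0`) is PROVED for perfect perf-factorial `M` (`isPrimary_mul_iff_of_isPerfect`;
in Prop. 4.1, `Φ(A)` is perfect by Prop. 1.10 (iii)). Multiplicative notation as in `Monoids.lean`.
No new definitions.
-/

namespace Literature.AlgebraicGeometry.Frobenioids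

open Function

universe u

variable {M : Type u} [CommMonoid M]

/-! ### §0 supplements -/

/-- In `M_𝔭`: every element times a suitable element of `M_𝔭` is a multiple of any given non-zero
element of `M_𝔭` (all non-zero elements of `M_𝔭` are `≼`-equivalent, §0 p. 12).
[cite: MochizukiFrdI2008, §0 p.12] -/
theorem Primes.exists_mul_eq_pow_of_mem_submonoid {N : Type u} [CommMonoid N] (𝔭 : Primes N)
    {u w : N} (hu : u ∈ 𝔭.submonoid) (hw : w ∈ 𝔭.submonoid) (hw1 : w ≠ 1) :
    ∃ n : ℕ, 0 < n ∧ ∃ c ∈ 𝔭.submonoid, u * c = w ^ n := by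
  obtain ⟨⟨p, hp'⟩, hp⟩ := Quotient.exists_rep 𝔭
  have hpc : p ∈ 𝔭.carrier := ⟨hp', hp⟩
  have hwc : w ∈ 𝔭.carrier := ((𝔭.mem_submonoid_iff hpc w).mp hw).resolve_left hw1
  obtain ⟨n, hn, c, hc⟩ := 𝔭.precsim_of_mem_submonoid hwc hu
  exact ⟨n, hn, c, 𝔭.mem_submonoid_of_dvd (Dvd.intro_left u hc.symm) (pow_mem hw n), hc.symm⟩

/-- The supremum of `{0}` is `0` (in a sharp monoid). [cite: MochizukiFrdI2008, §0 p.12] -/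
theorem divSup_singleton_one {N : Type u} [CommMonoid N] (hN : IsSharp N) :
    divSup ({1} : Set N) = 1 := by
  have h : ∃ s : N, ∀ b : N, IsBoundedBy ({1} : Set N) b ↔ s ∣ b :=
    ⟨1, fun b => ⟨fun _ => one_dvd b, fun _ a ha => by rw [Set.mem_singleton_iff.mp ha]; exact one_dvd b⟩⟩
  have hs : divSup ({1} : Set N) ∣ 1 :=
    (divSup_spec h (1 : N)).mp fun a ha => by rw [Set.mem_singleton_iff.mp ha]
  exact hN.eq_one_of_isUnit _ (isUnit_of_dvd_one hs)

/-! ### Coordinates of a primary element (Def. 2.4 (i)(c)) -/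

section Components

variable (M)

/-- For `q ∈ 𝔮` primary, the set `Bound_{𝔮' ∪ {0}}(q)` at another prime `𝔮' ≠ 𝔮` is `{0}`: a
primary element of class `𝔮'` dividing `q` would lie in the class `𝔮`.
[cite: MochizukiFrdI2008, Def. 2.4(i) p.47] -/
theorem boundAt_eq_singleton_of_ne {𝔮 𝔮' : Primes (Perfection M)} {q : Perfection M}
    (hq : q ∈ 𝔮.carrier) (hne : 𝔮' ≠ 𝔮) : boundAt M 𝔮' q = {1} := by
  ext y
  simp only [boundAt, Set.mem_setOf_eq, Set.mem_singleton_iff]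
  constructor
  · rintro ⟨x, hx | hx, hxq, rfl⟩
    · exfalso
      obtain ⟨hprim, hcls'⟩ := hx
      obtain ⟨hprim2, hcls⟩ := 𝔮.mem_carrier_of_precsim hq hprim.1 (Precsim.of_dvd hxq)
      exact hne (hcls'.symm.trans hcls)
    · have hx1 : x = 1 := Subtype.ext hx
      rw [hx1, map_one]
  · rintro rfl
    exact ⟨1, Or.inr rfl, one_dvd q, (map_one _).symm⟩

/-- The coordinates of a primary element `q ∈ 𝔮` vanish at every prime `𝔮' ≠ 𝔮`.
[cite: MochizukiFrdI2008, Def. 2.4(i) p.47] -/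
theorem factorMap_apply_of_ne {𝔮 𝔮' : Primes (Perfection M)} {q : Perfection M}
    (hq : q ∈ 𝔮.carrier) (hne : 𝔮' ≠ 𝔮) : factorMap M q 𝔮' = 1 := by
  show divSup (boundAt M 𝔮' q) = 1
  rw [boundAt_eq_singleton_of_ne M hq hne, divSup_singleton_one (isSharp_realification _)]

variable {M}

/-- In a perf-factorial monoid the `𝔮`-coordinate of a primary element `q ∈ 𝔮` is non-zero (the
factorization homomorphism is injective and `q ≠ 0`). [cite: MochizukiFrdI2008, Def. 2.4(i) p.47] -/
theorem IsPerfFactorial.factorMap_apply_ne_one (h : IsPerfFactorial M) {𝔮 : Primes (Perfection M)}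
    {q : Perfection M} (hq : q ∈ 𝔮.carrier) : factorMap M q 𝔮 ≠ 1 := by
  intro h1
  obtain ⟨hprim, hcls⟩ := hq
  apply hprim.1
  apply h.factorMap_injective
  rw [h.factorMap_one]
  funext 𝔮'
  by_cases e : 𝔮' = 𝔮
  · rw [e, h1]; rfl
  · rw [factorMap_apply_of_ne M ⟨hprim, hcls⟩ e]; rfl

/-! ### Condition (d) in use -/

/-- Divisibility in `M^pf` from divisibility inside `M^pf_factor` (Def. 2.4 (i)(d) + injectivity of
the factorization homomorphism; this is one half of "an inequality `a ≤ b` holds in `M^pf` if and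
only if it holds in `M^pf_factor`"). [cite: MochizukiFrdI2008, Def. 2.4(i) p.47] -/
theorem IsPerfFactorial.dvd_of_factorMap_mul_eq (h : IsPerfFactorial M) {a b : Perfection M}
    {x : PfFactor M} (he : factorMap M a * pfFactorToRlfFactor M x = factorMap M b) : a ∣ b := by
  have hsupp : supp (pfFactorToRlfFactor M x) ⊆ supp (factorMap M b) := by
    rw [← he, mul_comm]
    exact supp_subset_supp_mul _ _
  obtain ⟨c, hc⟩ := h.mem_range_of_supp_subset x b hsupp
  exact ⟨c, h.factorMap_injective (by rw [h.factorMap_mul, hc, he])⟩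

/-- **The `𝔮`-component and the `𝔮`-free part** (Def. 2.4 (i)(c)(d); "the primary factorizations",
pp. 76–77): every `y ∈ M^pf` is `y₁ + y₂` with `y₁` having as only possibly non-zero coordinate the
`𝔮`-coordinate of `y`, and `y₂` with zero `𝔮`-coordinate. [cite: MochizukiFrdI2008, Def. 2.4(i) p.47] -/
theorem IsPerfFactorial.exists_split (h : IsPerfFactorial M) (y : Perfection M)
    (𝔮 : Primes (Perfection M)) :
    ∃ (y₁ y₂ : Perfection M) (x₁ : PfAt M 𝔮), y₁ * y₂ = y ∧
      (haveI := Classical.decEq (Primes (Perfection M));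
        factorMap M y₁ = pfFactorToRlfFactor M (Pi.mulSingle 𝔮 x₁)) ∧ factorMap M y₂ 𝔮 = 1 := by
  classical
  obtain ⟨x, hx⟩ := h.factorMap_mem_range y
  have h1 : supp (pfFactorToRlfFactor M (Pi.mulSingle 𝔮 (x 𝔮))) ⊆ supp (factorMap M y) := by
    intro 𝔮' h𝔮'
    simp only [supp, Set.mem_setOf_eq, pfFactorToRlfFactor_apply] at h𝔮' ⊢
    by_cases e : 𝔮' = 𝔮
    · subst e
      rw [Pi.mulSingle_eq_same] at h𝔮'
      rw [← hx, pfFactorToRlfFactor_apply]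
      exact h𝔮'
    · rw [Pi.mulSingle_eq_of_ne e, map_one] at h𝔮'
      exact absurd rfl h𝔮'
  have h2 : supp (pfFactorToRlfFactor M (Function.update x 𝔮 1)) ⊆ supp (factorMap M y) := by
    intro 𝔮' h𝔮'
    simp only [supp, Set.mem_setOf_eq, pfFactorToRlfFactor_apply] at h𝔮' ⊢
    by_cases e : 𝔮' = 𝔮
    · subst e
      rw [Function.update_self, map_one] at h𝔮'
      exact absurd rfl h𝔮'
    · rw [Function.update_of_ne e] at h𝔮'
      rw [← hx, pfFactorToRlfFactor_apply]
      exact h𝔮'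
  obtain ⟨y₁, hy₁⟩ := h.mem_range_of_supp_subset _ y h1
  obtain ⟨y₂, hy₂⟩ := h.mem_range_of_supp_subset _ y h2
  refine ⟨y₁, y₂, x 𝔮, h.factorMap_injective ?_, hy₁, ?_⟩
  · rw [h.factorMap_mul, hy₁, hy₂, ← map_mul, ← hx]
    congr 1
    funext 𝔮'
    rw [Pi.mul_apply]
    by_cases e : 𝔮' = 𝔮
    · subst e
      rw [Pi.mulSingle_eq_same, Function.update_self, mul_one]
    · rw [Pi.mulSingle_eq_of_ne e, Function.update_of_ne e, one_mul]
  · rw [hy₂, pfFactorToRlfFactor_apply, Function.update_self, map_one]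

/-- No element of `𝔮` divides an element with zero `𝔮`-coordinate.
[cite: MochizukiFrdI2008, Def. 2.4(i) p.47] -/
theorem IsPerfFactorial.not_dvd_of_factorMap_apply_eq_one (h : IsPerfFactorial M)
    {𝔮 : Primes (Perfection M)} {q y₂ : Perfection M} (hq : q ∈ 𝔮.carrier)
    (hy₂ : factorMap M y₂ 𝔮 = 1) : ¬ q ∣ y₂ := by
  intro hdvd
  obtain ⟨c, hc⟩ := map_dvd h.factorHom hdvd
  have h1 : factorMap M q 𝔮 ∣ 1 := ⟨c 𝔮, by
    have e := congrFun hc 𝔮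
    rw [h.factorHom_apply, hy₂] at e
    exact e⟩
  exact h.factorMap_apply_ne_one hq ((isSharp_realification _).eq_one_of_isUnit _ (isUnit_of_dvd_one h1))

/-- An element supported at the single prime `𝔮` is `≼ p` for every `p ∈ 𝔮` (its `𝔮`-coordinate
lies in `M^pf_𝔮`, all of whose non-zero elements are `≼`-equivalent; then Def. 2.4 (i)(d)).
[cite: MochizukiFrdI2008, Def. 2.4(i) p.47] -/
theorem IsPerfFactorial.precsim_of_factorMap_eq_mulSingle (h : IsPerfFactorial M)
    {𝔮 : Primes (Perfection M)} {y₁ p : Perfection M} (hp : p ∈ 𝔮.carrier) (x₁ : PfAt M 𝔮)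
    (hy₁ : haveI := Classical.decEq (Primes (Perfection M));
      factorMap M y₁ = pfFactorToRlfFactor M (Pi.mulSingle 𝔮 x₁)) : y₁ ≼ p := by
  classical
  obtain ⟨xp, hxp⟩ := h.factorMap_mem_range p
  have hw1 : (xp 𝔮 : Perfection M) ≠ 1 := by
    intro hw
    apply h.factorMap_apply_ne_one hp
    rw [← hxp, pfFactorToRlfFactor_apply, show xp 𝔮 = 1 from Subtype.ext hw, map_one]
  obtain ⟨n, hn, c, hc, hxc⟩ :=
    𝔮.exists_mul_eq_pow_of_mem_submonoid (x₁).2 (xp 𝔮).2 hw1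
  refine ⟨n, hn, h.dvd_of_factorMap_mul_eq (x := Function.update (xp ^ n) 𝔮 ⟨c, hc⟩) ?_⟩
  rw [show factorMap M (p ^ n) = factorMap M p ^ n from map_pow h.factorHom p n, hy₁, ← map_mul,
    ← hxp, ← map_pow]
  congr 1
  funext 𝔮'
  rw [Pi.mul_apply, Pi.pow_apply]
  by_cases e : 𝔮' = 𝔮
  · subst e
    rw [Pi.mulSingle_eq_same, Function.update_self]
    exact Subtype.ext hxc
  · rw [Pi.mulSingle_eq_of_ne e, Function.update_of_ne e, one_mul, Pi.pow_apply]

end Components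

/-! ### Proposition 4.1 (ii), the monoid statement -/

/-- **Proposition 4.1 (ii) in the language of monoids** (FrdI p. 76): in a perfect perf-factorial
monoid, for `x` primary and `y ≠ 0`, `x + y` is primary iff "for every equation `x + y = x' + y'`,
where `x', y' ≠ 0`, there exists a `0 ≠ x''` such that `x'' ≤ x`, `x'' ≤ x'`". Necessity: "the
structure of the `Φ(A)_𝔭`" (Def. 2.4 (i)(b)); sufficiency: "by taking `x_φ' ≤ x_ψ` [cf. Definition
2.4, (i), (c), (d); the fact that `Φ(A)` is perfect]" — here: split `y` at the prime of `x`; a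
non-trivial `𝔭`-free part `x'` of `y` would acquire a divisor from `𝔭`, so `y` is `𝔭`-supported,
`y ≼ x`, and `x + y ≼ x` is primary. [cite: MochizukiFrdI2008, Prop. 4.1 (ii) p.76] -/
theorem IsPerfFactorial.isPrimary_mul_iff_of_isPerfect (h : IsPerfFactorial M) (hperf : IsPerfect M)
    {X Y : M} (hX : IsPrimary X) (hY : Y ≠ 1) :
    IsPrimary (X * Y) ↔ ∀ X' Y' : M, X' ≠ 1 → Y' ≠ 1 → X * Y = X' * Y' →
      ∃ X'' : M, X'' ≠ 1 ∧ X'' ∣ X ∧ X'' ∣ X' := by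
  have hM : IsSharp M := h.isDivisorial.isSharp
  have _ := hY
  constructor
  · intro hXY X' Y' hX' _ he
    exact h.exists_common_dvd_of_isPrimary_mul hX hXY hX' he
  · intro hcond
    have hbij := isPerfect_iff_bijective_of.mp hperf
    have hxprim : IsPrimary (Perfection.of M X) := (Perfection.isPrimary_of_iff hM).mpr hX
    let 𝔮 : Primes (Perfection M) := Quotient.mk _ ⟨Perfection.of M X, hxprim⟩
    have hx𝔮 : Perfection.of M X ∈ 𝔮.carrier := mem_carrier_mk_of_isPrimary hxprim
    obtain ⟨y₁, y₂, x₁, hy, hy₁, hy₂⟩ := h.exists_split (Perfection.of M Y) 𝔮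
    obtain ⟨Y₁, rfl⟩ := hbij.2 y₁
    obtain ⟨Y₂, rfl⟩ := hbij.2 y₂
    have hYfac : Y₁ * Y₂ = Y := hbij.1 (by rw [map_mul, hy])
    by_cases hY₂ : Y₂ = 1
    · -- `y` is supported at the prime of `x`: `y ≼ x`, hence `x + y ≼ x` is primary
      have hYX : Y ≼ X := by
        rw [← hYfac, hY₂, mul_one]
        exact Perfection.of_precsim_of_iff.mp (h.precsim_of_factorMap_eq_mulSingle hx𝔮 x₁ hy₁)
      obtain ⟨n, hn, c, hc⟩ := hYX
      refine hX.of_precsim ⟨n + 1, Nat.succ_pos n, c, ?_⟩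
        (fun e => hX.1 (hM.eq_one_of_isUnit _ (IsUnit.of_mul_eq_one Y e)))
      rw [pow_succ', hc, ← mul_assoc]
    · -- a non-trivial `𝔮`-free part of `y` would have a divisor from `𝔮`
      exfalso
      have hXY₁ : X * Y₁ ≠ 1 :=
        fun e => hX.1 (hM.eq_one_of_isUnit _ (IsUnit.of_mul_eq_one Y₁ e))
      obtain ⟨X'', hX''1, hX''X, hX''Y₂⟩ :=
        hcond Y₂ (X * Y₁) hY₂ hXY₁ (by rw [← hYfac, ← mul_assoc, mul_comm (X * Y₁)])
      have h1 : Perfection.of M X'' ∈ 𝔮.carrier :=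
        𝔮.mem_carrier_of_precsim hx𝔮 (fun e => hX''1 (hbij.1 (by rw [e, map_one])))
          (Precsim.map (Perfection.of M) (Precsim.of_dvd hX''X))
      exact h.not_dvd_of_factorMap_apply_eq_one h1 hy₂ (map_dvd (Perfection.of M) hX''Y₂)

end Literature.AlgebraicGeometry.Frobenioids
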